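import Literature.AlgebraicGeometry.Resolution.QuadraticTransformsRegular
import Literature.AlgebraicGeometry.Resolution.MvPowerSeriesChainRule
import Literature.AlgebraicGeometry.Resolution.FormalFibresRegularProofs
import Literature.AlgebraicGeometry.Resolution.AdicCompletionRegular
import Literature.AlgebraicGeometry.Resolution.RsopMonomialIdeals
import Literature.AlgebraicGeometry.Resolution.RegularLocalRingsQuotient
import Literature.RingTheory.CompleteLocalRings.CoefficientField
import Mathlib.RingTheory.AdicCompletion.LocalRing
import Mathlib.RingTheory.Derivation.Basic
import Mathlib.RingTheory.LocalRing.ResidueField.Basic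
import Mathlib.Algebra.CharP.Subring
import Mathlib.FieldTheory.Perfect
import HarnessLib

/-!
# T1 `chart_zero` — the Cohen chart of a dominated regular local subring (chain W4.1, crux `Steer`)

Topic: `Summits/ResolutionOfSingularities/ResolutionOfSingularities/Theorems`. Helper (seam **T1** of
the dictionary behind the registered stub `stub_core4Dictionary` of the line `switching_dichotomy` r9 on
`Theses.FrobeniusClosing.Steer`, stmt-ResolutionOfSingularities-16345; signature = res-L0-w41-lead-1's
`DICT-SIGS.lean` `chart_zero` VERBATIM with the abbreviations `centre` / `FC1` / `FC2` inlined; no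
`Theses.*` / `Cruxes.*` import, per the chain's build rule).

**Statement (`chart_zero`).** Let `K` be a field of characteristic `p`, `O` a valuation ring of `K`,
`κ` a field receiving the residue field of `O` (`ι : ResidueField O →+* κ`), and `R ⊆ O` a regular local
subring DOMINATED by `O` (`𝔪_O ∩ R = 𝔪_R`) of embedding dimension `d`. For every `x ∈ 𝔪_R ∖ 𝔪_R²` and
every `j : Fin d` there is a ring homomorphism `φ : R →+* κ⟦X_1, …, X_d⟧` with
(FC1) constant coefficients are residues, `constantCoeff (φ r) = ι (res_O r)`;
(FC2) the centre generates the maximal ideal, `φ(𝔪_O ∩ R)·κ⟦X⟧ = (X_1, …, X_d)`;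
and `φ x = X_j`.

**Proof.** Extend `x` to a regular system of parameters `z` with `z_j = x` (Matsumura Thm. 14.2:
`R/(x)` is regular of dimension `d - 1`, `IsRsopPart.of_isRegularLocalRing_quotient`, `IsRsopPart.exists_rsop`).
The completion `R̂` is a complete regular local ring of embedding dimension `d` containing the prime field
`𝔽_p` (`isRegularLocalRing_adicCompletion`, Mathlib's `AdicCompletion.maximalIdeal_eq_map` /
`spanFinrank_maximalIdeal_eq`), so it has a coefficient field (Cohen, Matsumura Thm. 28.3 (ii):
`CoefficientField.exists_ringHom_comp_residue_eq_id`) and the expansion map `K'⟦X⟧ → R̂`, `X_i ↦ z_i`, is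
bijective (Matsumura Thm. 29.7 with CHOSEN parameters: `exists_adicEvalHom` + `comp_map_bijective`), with
constant coefficient = residue (the expansion of `g - g(0)` lies in `𝔪̂`). Push the coefficients along
`K' = ResidueField R̂ ≅ ResidueField R → ResidueField O → κ` (`AdicCompletion.residueField_map_bijective`; the
inclusion `R → O` is local by domination) with `MvPowerSeries.map`.

Everything here is OURS (campaign res-hironaka, rung L, slot W4.1); it replaces the role of no printed item and
is NOT a statement of the manuscript under review [claim: Hironaka2017, status: under-review]. Sources for the
classical inputs: H. Matsumura, *Commutative Ring Theory*, CUP 1986, Thm. 14.2, Thm. 28.3 (ii), Thm. 29.7.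
-/

set_option linter.dupNamespace false

noncomputable section

open IsLocalRing Literature.AlgebraicGeometry.Resolution MvPowerSeries

namespace Summit.ResolutionOfSingularities.ResolutionOfSingularities.Theorems.SwitchingDichotomy.ChartZero

universe u

/-! ## A regular system of parameters through a given element of `𝔪 ∖ 𝔪²` -/

/-- In a regular local ring of embedding dimension `d`, an element `x ∈ 𝔪 ∖ 𝔪²` is the `j`-th member of
some regular system of parameters, for any prescribed `j : Fin d` (Matsumura Thm. 14.2: `R/(x)` is regular
of dimension `d - 1`, so `x` is part of a minimal basis of `𝔪`; then permute).
[cite: Matsumura1987, Thm. 14.2] -/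
theorem exists_rsop_apply_eq {R : Type u} [CommRing R] [IsRegularLocalRing R] {d : ℕ}
    (hd : (maximalIdeal R).spanFinrank = d) {x : R} (hx : x ∈ maximalIdeal R)
    (hx2 : x ∉ maximalIdeal R ^ 2) (j : Fin d) :
    ∃ z : Fin d → R, Ideal.span (Set.range z) = maximalIdeal R ∧ z j = x := by
  classical
  obtain ⟨hq, hdim⟩ := IsRegularLocalRing.quotient_span_singleton hx hx2
  let z₁ : Fin 1 → R := fun _ => x
  have hr : Set.range z₁ = {x} := Set.range_const
  have hq' : IsRegularLocalRing (R ⧸ Ideal.span (Set.range z₁)) := by rw [hr]; exact hq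
  have hdim' : ringKrullDim (R ⧸ Ideal.span (Set.range z₁)) + (1 : ℕ) ≤ ringKrullDim R := by
    rw [hr, Nat.cast_one]
    exact hdim.le
  have hpart : IsRsopPart z₁ :=
    IsRsopPart.of_isRegularLocalRing_quotient (fun _ => hx) (hq := hq') hdim'
  obtain ⟨e, w, hsf, hspan, hw⟩ := hpart.exists_rsop
  have hde : d = 1 + e := hd.symm.trans hsf
  let σ : Fin d ≃ Fin (1 + e) := finCongr hde
  let i₀ : Fin (1 + e) := Fin.castAdd e 0
  let τ : Fin d ≃ Fin (1 + e) := σ.trans (Equiv.swap (σ j) i₀)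
  refine ⟨w ∘ τ, ?_, ?_⟩
  · rw [τ.surjective.range_comp]
    exact hspan
  · change w (Equiv.swap (σ j) i₀ (σ j)) = x
    rw [Equiv.swap_apply_left]
    exact hw 0

/-! ## Domination: the centre of `O` on `R` is the maximal ideal, and `R → O` is local -/

section Domination

variable {K : Type} [Field K] (O : ValuationSubring K) (R : Subring K) (hR : R ≤ O.toSubring)

/-- For `R ⊆ O` local and dominated by `O`, the centre `𝔪_O ∩ R` of `O` on `R` is the maximal ideal of
`R`. [folklore] -/
theorem comap_maximalIdeal_eq_of_subringDominates [IsLocalRing R]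
    (hdom : SubringDominates R O.toSubring) :
    Ideal.comap (Subring.inclusion hR) (maximalIdeal O) = maximalIdeal R := by
  ext a
  rw [Ideal.mem_comap, (subringDominates_valuationSubring_iff hR).mp hdom a,
    ValuationSubring.valuation_lt_one_iff]
  rfl

/-- For `R ⊆ O` local and dominated by `O`, the inclusion `R → O` is a local homomorphism.
[folklore] -/
theorem isLocalHom_inclusion_of_subringDominates [IsLocalRing R]
    (hdom : SubringDominates R O.toSubring) : IsLocalHom (Subring.inclusion hR) := by
  refine ⟨fun a ha => ?_⟩
  by_contra hna
  have hmem : a ∈ maximalIdeal R := (IsLocalRing.mem_maximalIdeal a).mpr hna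
  rw [← comap_maximalIdeal_eq_of_subringDominates O R hR hdom, Ideal.mem_comap] at hmem
  exact (IsLocalRing.mem_maximalIdeal _).mp hmem ha

end Domination

/-! ## Cohen coordinates of the completion with chosen parameters and residues as constant coefficients -/

/-- **Cohen coordinates of `R̂` with CHOSEN parameters, recording constant coefficients.** For a regular
local ring `R` of characteristic `p` (prime) and embedding dimension `d` and generators `z_1, …, z_d` of
`𝔪_R`, there is a ring isomorphism `e : R̂ ≃+* K'⟦X_1, …, X_d⟧`, `K'` the residue field of the completion
`R̂`, with `e(z_i) = X_i` and `constantCoeff (e a) = res(a)` for all `a ∈ R̂` (Matsumura Thm. 29.7 with the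
proof of Thm. 29.4; coefficient field from Thm. 28.3 (ii) applied to the prime field `𝔽_p ⊆ R̂`).
[cite: Matsumura1987, Thm. 29.7] -/
theorem exists_ringEquiv_adicCompletion_constantCoeff (p : ℕ) [Fact p.Prime] (R : Type u) [CommRing R]
    [IsRegularLocalRing R] [CharP R p] {d : ℕ} (hd : (maximalIdeal R).spanFinrank = d)
    (z : Fin d → R) (hz : Ideal.span (Set.range z) = maximalIdeal R) :
    ∃ e : AdicCompletion (maximalIdeal R) R ≃+*
        MvPowerSeries (Fin d) (ResidueField (AdicCompletion (maximalIdeal R) R)),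
      (∀ i, e (algebraMap R (AdicCompletion (maximalIdeal R) R) (z i)) = X i) ∧
      ∀ a, constantCoeff (e a) = residue (AdicCompletion (maximalIdeal R) R) a := by
  set A := AdicCompletion (maximalIdeal R) R with hA
  haveI : IsRegularLocalRing A := isRegularLocalRing_adicCompletion R
  -- `R → R̂` is injective, so `R̂` has characteristic `p` and is an `𝔽_p`-algebra
  have hinj : Function.Injective (algebraMap R A) := fun a b h =>
    AdicCompletion.of_injective (maximalIdeal R) R h
  haveI : CharP A p := charP_of_injective_algebraMap hinj p
  letI : Algebra (ZMod p) A := ZMod.algebra A p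
  -- a coefficient field of `R̂`: a section `σ` of its residue map
  obtain ⟨σ, hσ⟩ := Literature.RingTheory.CompleteLocalRings.exists_ringHom_comp_residue_eq_id A (ZMod p)
  -- the regular system of parameters `z` of `R̂`
  let z' : Fin d → A := fun i => algebraMap R A (z i)
  have hmax : maximalIdeal A = (maximalIdeal R).map (algebraMap R A) :=
    AdicCompletion.maximalIdeal_eq_map
  have hz' : Ideal.span (Set.range z') = maximalIdeal A := by
    have h1 : (Ideal.span (Set.range z)).map (algebraMap R A) = Ideal.span (Set.range z') := by
      rw [Ideal.map_span, ← Set.range_comp]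
      rfl
    rw [← h1, hz]
    exact hmax.symm
  have hz'm : ∀ i, z' i ∈ maximalIdeal A := fun i => hz' ▸ Ideal.subset_span ⟨i, rfl⟩
  have hd' : (maximalIdeal A).spanFinrank = d := by
    rw [AdicCompletion.spanFinrank_maximalIdeal_eq]
    exact hd
  -- the expansion map `K'⟦X⟧ → R̂`, `Xᵢ ↦ zᵢ`, coefficients through `σ`, is bijective
  obtain ⟨Φ, hΦ₁, hΦ₂⟩ := exists_adicEvalHom (maximalIdeal A) z' hz'm
  have hbij := comp_map_bijective σ hσ hd' z' hz' Φ hΦ₁ hΦ₂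
  let e₀ : A ≃+* MvPowerSeries (Fin d) (ResidueField A) := (RingEquiv.ofBijective _ hbij).symm
  have happly : ∀ g, e₀.symm g = Φ (MvPowerSeries.map σ g) := fun g => rfl
  refine ⟨e₀, fun i => ?_, fun a => ?_⟩
  · apply e₀.symm.injective
    rw [RingEquiv.symm_apply_apply, happly, MvPowerSeries.map_X, ← MvPolynomial.coe_X, hΦ₁,
      MvPolynomial.eval_X]
  · -- `a = Φ(σ g)` with `g := e a`; `Φ(σ (g - g₀))` lies in `𝔪̂`, so `res a = res (σ g₀) = g₀`
    set g := e₀ a with hg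
    have ha : a = Φ (MvPowerSeries.map σ g) := by
      rw [← happly, hg, RingEquiv.symm_apply_apply]
    have hC : Φ (MvPowerSeries.map σ (C (constantCoeff g))) = σ (constantCoeff g) := by
      rw [MvPowerSeries.map_C, ← MvPolynomial.coe_C, hΦ₁, MvPolynomial.eval_C]
    have hmem : a - σ (constantCoeff g) ∈ maximalIdeal A := by
      rw [ha, ← hC, ← map_sub, ← map_sub, ← pow_one (maximalIdeal A)]
      refine hΦ₂ 1 _ fun x hx => ?_
      have hx0 : x = 0 := by
        have : x.degree = 0 := Nat.lt_one_iff.mp hx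
        exact (Finsupp.degree_eq_zero_iff x).mp this
      subst hx0
      rw [MvPowerSeries.coeff_map, map_sub, MvPowerSeries.coeff_C, if_pos rfl,
        MvPowerSeries.coeff_zero_eq_constantCoeff_apply, sub_self, map_zero]
    have hres : residue A a - residue A (σ (constantCoeff g)) = 0 := by
      rw [← map_sub, IsLocalRing.residue_eq_zero_iff]
      exact hmem
    rw [sub_eq_zero, hσ] at hres
    exact hres.symm

/-! ## T1 `chart_zero` -/

/-- **T1 `chart_zero`** (res-L0-w41-lead-1's DICT-SIGS signature, `centre`/`FC1`/`FC2` inlined). A regular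
local subring `R ⊆ O` of `K` dominated by `O`, `char K = p`, with embedding dimension `d`, has a formal chart
`φ : R →+* κ⟦X_1, …, X_d⟧` in `d` variables — constant coefficients are residues (FC1), the centre `𝔪_O ∩ R`
generates `(X_1, …, X_d)` (FC2) — sending a prescribed `x ∈ 𝔪 ∖ 𝔪²` to the prescribed variable `X_j`.
Route: `exists_rsop_apply_eq` (extend `x` to a regular system of parameters),
`exists_ringEquiv_adicCompletion_constantCoeff` (Cohen coordinates of `R̂` with those parameters), then push
the coefficients along `ResidueField R̂ ≅ ResidueField R → ResidueField O → κ` (`MvPowerSeries.map`).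
[cite: Matsumura1987, Thm. 29.7] -/
theorem chart_zero {K : Type} [Field K] (O : ValuationSubring K) {κ : Type} [Field κ]
    (ι : IsLocalRing.ResidueField O →+* κ)
    (p : ℕ) [Fact p.Prime] [CharP K p] (R : Subring K) (hR : R ≤ O.toSubring)
    [IsRegularLocalRing R] (hdom : SubringDominates R O.toSubring) (d : ℕ)
    (hd : (IsLocalRing.maximalIdeal R).spanFinrank = d)
    (x : R) (hx : x ∈ IsLocalRing.maximalIdeal R) (hx2 : x ∉ IsLocalRing.maximalIdeal R ^ 2)
    (j : Fin d) :
    ∃ φ : R →+* MvPowerSeries (Fin d) κ,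
      (∀ r : R, constantCoeff (φ r) = ι (IsLocalRing.residue O (Subring.inclusion hR r))) ∧
      Ideal.map φ (Ideal.comap (Subring.inclusion hR) (IsLocalRing.maximalIdeal O)) =
        Ideal.span (Set.range (X : Fin d → MvPowerSeries (Fin d) κ)) ∧
      φ x = X j := by
  classical
  -- a regular system of parameters through `x`
  obtain ⟨z, hz, hzj⟩ := exists_rsop_apply_eq hd hx hx2 j
  -- Cohen coordinates of the completion
  set A := AdicCompletion (maximalIdeal R) R with hA
  obtain ⟨e, heX, hecc⟩ := exists_ringEquiv_adicCompletion_constantCoeff p R hd z hz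
  -- the coefficient map `ResidueField R̂ ≅ ResidueField R → ResidueField O → κ`
  let incl : R →+* O := Subring.inclusion hR
  haveI hloc : IsLocalHom incl := isLocalHom_inclusion_of_subringDominates O R hR hdom
  let eRA : ResidueField R ≃+* ResidueField A :=
    RingEquiv.ofBijective _ (AdicCompletion.residueField_map_bijective R)
  let θR : ResidueField R →+* κ := ι.comp (ResidueField.map incl)
  let θ : ResidueField A →+* κ := θR.comp eRA.symm.toRingHom
  have hθ : ∀ r : R, θ (residue A (algebraMap R A r)) = ι (residue O (incl r)) := by
    intro r
    have h1 : residue A (algebraMap R A r) = eRA (residue R r) := by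
      change _ = ResidueField.map (algebraMap R A) (residue R r)
      rw [ResidueField.map_residue]
    change θR (eRA.symm (residue A (algebraMap R A r))) = _
    rw [h1, RingEquiv.symm_apply_apply]
    change ι (ResidueField.map incl (residue R r)) = _
    rw [ResidueField.map_residue]
  -- the chart
  let φ : R →+* MvPowerSeries (Fin d) κ :=
    (MvPowerSeries.map (σ := Fin d) θ).comp (e.toRingHom.comp (algebraMap R A))
  have hφ : ∀ r : R, φ r = MvPowerSeries.map θ (e (algebraMap R A r)) := fun r => rfl
  -- FC2 bookkeeping: `𝔪_R ↦ 𝔪̂ = (z) ↦ (X) ↦ (X)`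
  have hmax : maximalIdeal A = (maximalIdeal R).map (algebraMap R A) :=
    AdicCompletion.maximalIdeal_eq_map
  have hz' : Ideal.span (Set.range fun i => algebraMap R A (z i)) = maximalIdeal A := by
    have h1 : (Ideal.span (Set.range z)).map (algebraMap R A) =
        Ideal.span (Set.range fun i => algebraMap R A (z i)) := by
      rw [Ideal.map_span, ← Set.range_comp]
      rfl
    rw [← h1, hz]
    exact hmax.symm
  have hmapz : Ideal.map e.toRingHom (maximalIdeal A) =
      Ideal.span (Set.range (X : Fin d → MvPowerSeries (Fin d) (ResidueField A))) := by
    rw [← hz', Ideal.map_span, ← Set.range_comp]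
    congr 1
    ext F
    constructor
    · rintro ⟨i, rfl⟩
      exact ⟨i, (heX i).symm⟩
    · rintro ⟨i, rfl⟩
      exact ⟨i, heX i⟩
  have hmapX : Ideal.map (MvPowerSeries.map (σ := Fin d) θ)
      (Ideal.span (Set.range (X : Fin d → MvPowerSeries (Fin d) (ResidueField A)))) =
      Ideal.span (Set.range (X : Fin d → MvPowerSeries (Fin d) κ)) := by
    rw [Ideal.map_span, ← Set.range_comp]
    congr 1
    ext F
    constructor
    · rintro ⟨i, rfl⟩
      exact ⟨i, (MvPowerSeries.map_X θ i).symm⟩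
    · rintro ⟨i, rfl⟩
      exact ⟨i, MvPowerSeries.map_X θ i⟩
  refine ⟨φ, fun r => ?_, ?_, ?_⟩
  · rw [hφ, MvPowerSeries.constantCoeff_map, hecc, hθ]
  · rw [comap_maximalIdeal_eq_of_subringDominates O R hR hdom]
    calc Ideal.map φ (maximalIdeal R)
        = Ideal.map (MvPowerSeries.map (σ := Fin d) θ)
            (Ideal.map e.toRingHom (Ideal.map (algebraMap R A) (maximalIdeal R))) := by
          rw [Ideal.map_map, Ideal.map_map]
          rfl
      _ = Ideal.span (Set.range (X : Fin d → MvPowerSeries (Fin d) κ)) := by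
          rw [← hmax, hmapz, hmapX]
  · rw [hφ, ← hzj, heX j, MvPowerSeries.map_X]

end Summit.ResolutionOfSingularities.ResolutionOfSingularities.Theorems.SwitchingDichotomy.ChartZero

end
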